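import Mathlib
import HarnessLib
import Summits.ValiantsHypothesis.ValiantsHypothesis.Theorems.LacunarySymmetroidMatrixDescartesProductPlusOneSeparatingWeightMeanPivot
import Summits.ValiantsHypothesis.ValiantsHypothesis.Theorems.LacunarySymmetroidMatrixDescartesProductPlusOnePosCoeff

/-!
# ValiantsHypothesis / LacunarySymmetroid — crux `MatrixDescartes` (stmt-ValiantsHypothesis-18050, V1),
# LINE (A) «product_plus_one»: the mean-ordered upper-signed sector, EXPLICIT LINEAR COUNT `≤ 2m + 1` (every `K`),
# and the PROPORTIONAL-TAILS sector

Completion of ✓ `…ProductPlusOneSeparatingWeightMeanPivot` (`sepWeight_meanOrdered_upperSigned`: every `K`, bottom coupling,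
upper-signed rows, tilted gap-means ordered ⇒ `Z₊(eulerNumerator) ≤ B + (B+1)` for any bound `Z₊(∏ f_j) ≤ B`).  Here the bound
`B = m` is supplied by Descartes (one sign change per row, ✓ `countP_pos_roots_le_one_of_extreme`), and the simplest mean-ordered
companies are exhibited:

* `sepWeight_upperSigned_pos_roots_le_one` — an upper-signed row at the bottom coupling (`a_{l₀} > 0 > a_l`, `d l₀ < d l`) has at
  most ONE positive zero; `sepWeight_upperSigned_prod` — the product is non-zero with `Z₊ ≤ m`;
* ★★★ `sepWeight_meanOrdered_upperSigned_le` — EVERY `K`, every support, bottom coupling: a mean-ordered company of `m` upper-signed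
  rows has `Z₊(eulerNumerator d a l₀) ≤ m + (m + 1)` — a LINEAR, ratio-free, window-free row of the c-free Euler count inside the
  every-`K` twin of the floor's open core (feeds the `EulerBoundPoly` / `stub_polyLaw` sector lists; for `K = 3` it is the
  ratio-ordered sector of ✓ `sepWeight_ratioOrdered_incoherent` in line currency);
* ★★ `sepWeight_proportionalTails_le` — PROPORTIONAL TAILS: rows `f_j = a_j X^{d_{l₀}} − s_j·Σ_{l ≠ l₀} t_l X^{d_l}` (`a_j, s_j, t_l > 0`:
  a common tail shape `t`, arbitrary positive heads `a_j` and scales `s_j`; any `m`, any `K`, any support) have EQUAL tilted means at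
  every point, hence `Z₊(eulerNumerator d a l₀) ≤ m + (m + 1)`.

HONEST FRAMING: sector/helper theorems for the research stubs `stub_oneChangeFloorK3` / `stub_polyLaw`; NOT those stubs, not
`MatrixDescartes`; `VP ≠ VNP` is NOT proved.  No definitions, no named facts, no sorry.
-/

set_option linter.dupNamespace false

namespace Summit.ValiantsHypothesis.ValiantsHypothesis.Theorems.LacunarySymmetroidMatrixDescartes

namespace ProductPlusOne

open Polynomial Finset
open scoped BigOperators

/-! ### §1 Descartes for an upper-signed row at the bottom coupling (every `K`) -/

/-- coefficients of a fewnomial row. [folklore] -/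
theorem sepWeight_coeff_fewnomial {K : ℕ} (d : Fin K → ℕ) (b : Fin K → ℝ) (i : ℕ) :
    (∑ l, C (b l) * X ^ (d l) : ℝ[X]).coeff i = ∑ l, if i = d l then b l else 0 := by
  rw [finsetSum_coeff]
  refine Finset.sum_congr rfl (fun l _ => ?_)
  rw [coeff_C_mul_X_pow]

/-- **An upper-signed row at the bottom coupling has at most ONE positive zero** (`a_{l₀} > 0`, `a_l < 0` for `l ≠ l₀`,
`d l₀ < d l`): one sign change, Descartes via ✓ `countP_pos_roots_le_one_of_extreme`. [this file's lemma] -/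
theorem sepWeight_upperSigned_pos_roots_le_one {K : ℕ} (d : Fin K → ℕ) (b : Fin K → ℝ) (l₀ : Fin K)
    (hd : ∀ l, l ≠ l₀ → d l₀ < d l) (hb : 0 < b l₀ ∧ ∀ l, l ≠ l₀ → b l < 0) :
    ((∑ l, C (b l) * X ^ (d l) : ℝ[X]).roots.toFinset.filter (fun t => 0 < t)).card ≤ 1 := by
  classical
  rw [← roots_neg]
  refine (StubVLawTwo.card_filter_pos_le_countP _).trans
    (countP_pos_roots_le_one_of_extreme _ (d l₀) (fun i hi => ?_) (Or.inl (fun i hi => ?_)))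
  · rw [coeff_neg, sepWeight_coeff_fewnomial, ← Finset.sum_neg_distrib]
    refine Finset.sum_nonneg (fun l _ => ?_)
    split_ifs with h
    · have hl : l ≠ l₀ := fun hl => hi (by rw [h, hl])
      have := hb.2 l hl
      linarith
    · simp
  · rw [coeff_neg, sepWeight_coeff_fewnomial, neg_eq_zero]
    refine Finset.sum_eq_zero (fun l _ => ?_)
    rw [if_neg]
    intro h
    by_cases hl : l = l₀
    · subst hl; omega
    · have := hd l hl; omega

/-- **The product of upper-signed rows**: non-zero, with at most `m` positive zeros. [this file's lemma] -/
theorem sepWeight_upperSigned_prod {m K : ℕ} (d : Fin K → ℕ) (a : Fin m → Fin K → ℝ) (l₀ : Fin K)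
    (hd : ∀ l, l ≠ l₀ → d l₀ < d l) (hup : ∀ j, 0 < a j l₀ ∧ ∀ l, l ≠ l₀ → a j l < 0) :
    (∏ j, ∑ l, C (a j l) * X ^ (d l) : ℝ[X]) ≠ 0 ∧ ((∏ j, ∑ l, C (a j l) * X ^ (d l) : ℝ[X]).roots.toFinset.filter (fun t => 0 < t)).card ≤ m := by
  classical
  have hne : ∀ j, (∑ l, C (a j l) * X ^ (d l) : ℝ[X]) ≠ 0 := by
    intro j h0
    have h := congrArg (fun q : ℝ[X] => q.coeff (d l₀)) h0
    simp only [sepWeight_coeff_fewnomial, coeff_zero] at h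
    rw [Finset.sum_eq_single l₀ (fun l _ hl => if_neg (fun h' => absurd h' (ne_of_lt (hd l hl))))
      (fun h' => absurd (Finset.mem_univ _) h'), if_pos rfl] at h
    exact (hup j).1.ne' h
  have hP0 : (∏ j, ∑ l, C (a j l) * X ^ (d l) : ℝ[X]) ≠ 0 := Finset.prod_ne_zero_iff.mpr (fun j _ => hne j)
  refine ⟨hP0, ?_⟩
  have hsub : ((∏ j, ∑ l, C (a j l) * X ^ (d l) : ℝ[X]).roots.toFinset.filter (fun t => 0 < t)) ⊆ Finset.univ.biUnion (fun j =>
        ((∑ l, C (a j l) * X ^ (d l) : ℝ[X]).roots.toFinset.filter (fun t => 0 < t))) := by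
    intro x hx
    rw [mem_filter, Multiset.mem_toFinset, mem_roots hP0, IsRoot.def, eval_prod, Finset.prod_eq_zero_iff] at hx
    obtain ⟨⟨j, _, hj⟩, hx0⟩ := hx
    rw [mem_biUnion]
    refine ⟨j, mem_univ _, ?_⟩
    rw [mem_filter, Multiset.mem_toFinset, mem_roots (hne j), IsRoot.def]
    exact ⟨hj, hx0⟩
  refine (card_le_card hsub).trans (card_biUnion_le.trans ?_)
  calc ∑ j, (((∑ l, C (a j l) * X ^ (d l) : ℝ[X]).roots.toFinset.filter (fun t => 0 < t))).card
      ≤ ∑ _j : Fin m, 1 :=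
        Finset.sum_le_sum (fun j _ => sepWeight_upperSigned_pos_roots_le_one d (a j) l₀ hd (hup j))
    _ = m := by simp

/-! ### §2 The explicit linear count, every `K` -/

/-- ★★★ **MEAN-ORDERED UPPER-SIGNED COMPANIES ARE LINEAR, EVERY `K`** (bottom coupling `d l₀ < d l`, some `l ≠ l₀`; rows
`a_{j l₀} > 0`, `a_{jl} < 0` for `l ≠ l₀`; at every `x > 0` every switched row's tilted gap-mean is at most every unswitched row's,
division-free `B⁽²⁾_j·B_i ≤ B⁽²⁾_i·B_j`): `Z₊(eulerNumerator d a l₀) ≤ m + (m + 1)`. [this file's theorem] -/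
theorem sepWeight_meanOrdered_upperSigned_le {m K : ℕ} (d : Fin K → ℕ) (a : Fin m → Fin K → ℝ) (l₀ : Fin K)
    (hd : ∀ l, l ≠ l₀ → d l₀ < d l) (hK : ∃ l : Fin K, l ≠ l₀)
    (hup : ∀ j, 0 < a j l₀ ∧ ∀ l, l ≠ l₀ → a j l < 0)
    (hord : ∀ z : ℝ, 0 < z → ∀ j i, (∑ l, a j l * z ^ (d l)) < 0 → 0 < (∑ l, a i l * z ^ (d l)) → (∑ l, ((d l : ℝ) - d l₀) ^ 2 * a j l * z ^ (d l)) * (∑ l, ((d l : ℝ) - d l₀) * a i l * z ^ (d l)) ≤ (∑ l, ((d l : ℝ) - d l₀) ^ 2 * a i l * z ^ (d l)) * (∑ l, ((d l : ℝ) - d l₀) * a j l * z ^ (d l))) :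
    ((∑ j, (∑ l, C (a j l * ((d l : ℝ) - d l₀)) * X ^ (d l)) * ∏ i ∈ Finset.univ.erase j, (∑ l, C (a i l) * X ^ (d l)) : ℝ[X]).roots.toFinset.filter (fun t => 0 < t)).card ≤ m + (m + 1) :=
  sepWeight_meanOrdered_upperSigned d a l₀ hd hK hup m (sepWeight_upperSigned_prod d a l₀ hd hup).2 hord

/-! ### §3 The proportional-tails sector -/

/-- ★★ **PROPORTIONAL TAILS** (every `K`, every support, bottom coupling `d l₀ < d l`, some `l ≠ l₀`): rows with a positive head
`a_{j l₀} > 0` and a COMMON negative tail shape, `a_{jl} = −s_j·t_l` for `l ≠ l₀` (`s_j > 0`, `t_l > 0`), have proportional stripped rows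
`B_j = −s_j·T₁`, `B⁽²⁾_j = −s_j·T₂`, so the company is mean-ordered (with equality) and `Z₊(eulerNumerator d a l₀) ≤ m + (m + 1)`.
[this file's theorem] -/
theorem sepWeight_proportionalTails_le {m K : ℕ} (d : Fin K → ℕ) (a : Fin m → Fin K → ℝ) (l₀ : Fin K)
    (hd : ∀ l, l ≠ l₀ → d l₀ < d l) (hK : ∃ l : Fin K, l ≠ l₀)
    (t : Fin K → ℝ) (s : Fin m → ℝ) (ht : ∀ l, l ≠ l₀ → 0 < t l) (hs : ∀ j, 0 < s j)
    (hhead : ∀ j, 0 < a j l₀) (htail : ∀ j, ∀ l, l ≠ l₀ → a j l = -(s j * t l)) :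
    ((∑ j, (∑ l, C (a j l * ((d l : ℝ) - d l₀)) * X ^ (d l)) * ∏ i ∈ Finset.univ.erase j, (∑ l, C (a i l) * X ^ (d l)) : ℝ[X]).roots.toFinset.filter (fun t => 0 < t)).card ≤ m + (m + 1) := by
  classical
  have hup : ∀ j, 0 < a j l₀ ∧ ∀ l, l ≠ l₀ → a j l < 0 := by
    intro j
    refine ⟨hhead j, fun l hl => ?_⟩
    rw [htail j l hl]
    exact neg_neg_of_pos (mul_pos (hs j) (ht l hl))
  refine sepWeight_meanOrdered_upperSigned_le d a l₀ hd hK hup (fun z _ j i _ _ => ?_)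
  -- the stripped rows factor through the common tail
  have h1 : ∀ j : Fin m, (∑ l, ((d l : ℝ) - d l₀) * a j l * z ^ (d l)) = -s j * ∑ l, ((d l : ℝ) - d l₀) * t l * z ^ (d l) := by
    intro j
    rw [Finset.mul_sum]
    refine Finset.sum_congr rfl (fun l _ => ?_)
    by_cases hl : l = l₀
    · subst hl; simp
    · rw [htail j l hl]; ring
  have h2 : ∀ j : Fin m, (∑ l, ((d l : ℝ) - d l₀) ^ 2 * a j l * z ^ (d l)) = -s j * ∑ l, ((d l : ℝ) - d l₀) ^ 2 * t l * z ^ (d l) := by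
    intro j
    rw [Finset.mul_sum]
    refine Finset.sum_congr rfl (fun l _ => ?_)
    by_cases hl : l = l₀
    · subst hl; simp
    · rw [htail j l hl]; ring
  rw [h2 j, h1 i, h2 i, h1 j]
  apply le_of_eq
  ring

end ProductPlusOne

end Summit.ValiantsHypothesis.ValiantsHypothesis.Theorems.LacunarySymmetroidMatrixDescartes
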